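import Literature.MathematicalPhysics.QuantumFieldTheory.Balaban1983to89.B9SectBStepWhole
import Literature.MathematicalPhysics.QuantumFieldTheory.Balaban1983to89.B9SectBCodedCarrier

/-!
# `Balaban1983to89.B9SectBStepPosFamilyTransfer` — the positive-input Sect.-B block-steps `StepPos` (ANY block: (3.42), (3.43), (3.44), (3.45), (3.47),
# (3.48), (3.46)ₙ) TRANSFER between two readings of the same operators whose blocks dominate each other, and from a CODING back to the record —
# the generic (block-parametric) form of `B9SectBStepL2FamilyTransferPos`

T. Bałaban, *Propagators for lattice gauge theories in a background field*, Commun. Math. Phys. **99** (1985) 389–434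
[`Balaban1985BackgroundPropagators`, "B9"], Theorem 3.1 (3.42)–(3.47) pp. 397–398, Theorem 3.2 (3.48) p. 398, Theorem 3.4 p. 400, Sect. B pp. 400–407,
p. 403 l.1–9 («of course with different constants»), (3.35)–(3.37) p. 396.

statement-level skeleton of published theorems with citation tags; proofs where landed; nothing here is a claim about the
Yang–Mills mass gap

WHY THIS FILE (pub-ymgap N06 row 13, seat dag-n06-c gen 11; interface word of the chain owner dag-n06-d g10: «StepPos currency», per-block knit by
`B9SectBStepWhole.sectBStepPrinted_of_posBlockSteps`).  The (O4) per-member programme transports EACH block-step of the coded family (the letters-level frames'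
output over the coded carrier) to the record's own reading: an input domination at the base (the record's Theorem-3.1–3.3 blocks give the coded family's, positive
constants) and an output domination at `U′U` (the coded family's block gives the record's).  `B9SectBStepL2FamilyTransferPos` is that bookkeeping for the one
block `StepL2Pos`; THIS FILE is the same bookkeeping ONCE for the generic `StepPos d c35 geo bg Gp GA Cinv C pos Out` (every `StepXPos` of `B9SectBStepWhole` §5 is
an instance), plus the named corollaries for the blocks (3.42) `StepEPos`, (3.47) `StepGlobPos`, (3.43) `StepH1Pos`, (3.44) `StepE4Pos`, (3.45) `StepH2Pos`,
(3.48) `StepKerPos`, (3.46)ₙ `StepL2nPos`.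
* §1 `stepPos_of_family_pos` — input domination `hin` + output domination `hout` at `(U, α₁)` (output statements and constant types may differ).
* §2 `stepPos_blk_of_family_pos` — the same for block-shaped outputs `∀ U′ ∈ (3.37)_{α₁}(U), Blk c i (U′U)`, `hout` at the products.
* §3 `stepPos_blk_of_coded` — block-shaped outputs read along a coding's decoding come back to the record under the class implication `hclass`
  (as `B9SectBCodedCarrier.sectBStepPrinted_of_coded` ∕ `B9SectBStepL2FamilyTransferPos.stepL2Pos_of_coded`); §3b `stepPos_base_of_coded` — outputs read at
  the base (the analytic-extension member), exponent rescaled by `r`.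
* §4 the named corollaries (`stepEPos_of_coded`, …, `stepL2nPos_of_coded`; `stepEPos_of_family_pos`, …).
Value = bookkeeping; NOT summit progress; N06 is not discharged by this file.
-/

namespace Literature.MathematicalPhysics.QuantumFieldTheory.Balaban1983to89.B9SectBStepPosFamilyTransfer

open Literature.MathematicalPhysics.QuantumFieldTheory.Balaban1983to89.B9 (Backgrounds Geometry KernelFamily SiteKernel Thms31to33IneqAt)
open Literature.MathematicalPhysics.QuantumFieldTheory.Balaban1983to89.B9FromB6 (EBlock L2Block GlobBlock H1Block E4Block H2Block)
open Literature.MathematicalPhysics.QuantumFieldTheory.Balaban1983to89.B9SectBStepWhole (StepPos StepEPos StepL2Pos StepL2nPos StepGlobPos StepH1Pos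
  StepE4Pos StepH2Pos StepKerPos)
open Literature.MathematicalPhysics.QuantumFieldTheory.Balaban1983to89.B9SectBCodedCarrier (CCfg Coding pullK pullS)

variable {I : Type} (d : ℕ) (c35 : ℝ) (geo : I → Geometry) (bg : I → Backgrounds)
  (Gp₁ Gp₂ GA₁ GA₂ : ∀ i, KernelFamily (geo i) (bg i)) (Cinv : ∀ i, SiteKernel (geo i) (bg i))

/-! ## §1 The generic transfer between mutually dominating readings -/

/-- ★ **THE POSITIVE-INPUT BLOCK-STEP TRANSFERS BETWEEN MUTUALLY DOMINATING READINGS — ANY OUTPUT STATEMENT.**  Inputs: `hin` — at every (3.35)-regular base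
(above a threshold, `Mα₀ ≦ ai`) the Theorem-3.1–3.3 blocks of `(Gp₂, GA₂, Cinv)` with POSITIVE constants give those of `(Gp₁, GA₁, Cinv)` with positive
constants, uniformly; `hout` — for every admissible output constant `c` (`pos₁ c`) and cap `a > 0` there are a cap `0 < a′ ≦ a`, a threshold, and an admissible
`c′` (`pos₂ c′`) such that at every regular `U` above the threshold and every `0 < α₁ ≦ a′` the output `Out₁ c i U α₁` gives `Out₂ c′ i U α₁`.  Then
`StepPos … Gp₁ GA₁ Cinv C₁ pos₁ Out₁` gives `StepPos … Gp₂ GA₂ Cinv C₂ pos₂ Out₂` (thresholds `max`, caps `min`; p. 403: *"of course with different constants"*).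
[cite: Balaban1985BackgroundPropagators, Thm 3.4 p.400, Sect. B pp.400–407, p.403 l.1–9, (3.35)–(3.37) p.396] -/
theorem stepPos_of_family_pos {C₁ C₂ : Type} {pos₁ : C₁ → Prop} {pos₂ : C₂ → Prop}
    {Out₁ : C₁ → ∀ i, (bg i).Cfg → ℝ → Prop} {Out₂ : C₂ → ∀ i, (bg i).Cfg → ℝ → Prop}
    (hin : ∀ (B₀ δ₀ : ℝ) (Bβ Bε : ℝ → ℝ) (Bεβ : ℝ → ℝ → ℝ) (B₁ δ₁ : ℝ), 0 < B₀ → 0 < δ₀ → 0 < B₁ → 0 < δ₁ →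
      ∃ (Mi ai B₀' δ₀' : ℝ) (Bβ' Bε' : ℝ → ℝ) (Bεβ' : ℝ → ℝ → ℝ) (B₁' δ₁' : ℝ), 0 < ai ∧ 0 < B₀' ∧ 0 < δ₀' ∧ 0 < B₁' ∧ 0 < δ₁' ∧
        ∀ i : I, Mi ≤ (geo i).M → ∀ α₀ : ℝ, 0 < α₀ → (geo i).M * α₀ ≤ ai → ∀ U : (bg i).Cfg, (bg i).Reg335 c35 α₀ U →
          Thms31to33IneqAt d (Gp₂ i) (GA₂ i) (Cinv i) B₀ δ₀ Bβ Bε Bεβ B₁ δ₁ U →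
          Thms31to33IneqAt d (Gp₁ i) (GA₁ i) (Cinv i) B₀' δ₀' Bβ' Bε' Bεβ' B₁' δ₁' U)
    (hout : ∀ c : C₁, pos₁ c → ∀ a : ℝ, 0 < a →
      ∃ (Mo ao a' : ℝ) (c' : C₂), 0 < ao ∧ 0 < a' ∧ a' ≤ a ∧ pos₂ c' ∧
        ∀ i : I, Mo ≤ (geo i).M → ∀ α₀ : ℝ, 0 < α₀ → (geo i).M * α₀ ≤ ao → ∀ U : (bg i).Cfg, (bg i).Reg335 c35 α₀ U →
          ∀ α₁ : ℝ, 0 < α₁ → α₁ ≤ a' → Out₁ c i U α₁ → Out₂ c' i U α₁)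
    (h : StepPos d c35 geo bg Gp₁ GA₁ Cinv C₁ pos₁ Out₁) :
    StepPos d c35 geo bg Gp₂ GA₂ Cinv C₂ pos₂ Out₂ := by
  intro B₀ δ₀ Bβ Bε Bεβ B₁ δ₁ hB₀ hδ₀ hB₁ hδ₁
  obtain ⟨Mi, ai, B₀i, δ₀i, Bβi, Bεi, Bεβi, B₁i, δ₁i, hai, hB₀i, hδ₀i, hB₁i, hδ₁i, Hin⟩ := hin B₀ δ₀ Bβ Bε Bεβ B₁ δ₁ hB₀ hδ₀ hB₁ hδ₁
  obtain ⟨M₀, a₁, a₀', c, hM₀, ha₁, ha₀', hc, H⟩ := h B₀i δ₀i Bβi Bεi Bεβi B₁i δ₁i hB₀i hδ₀i hB₁i hδ₁i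
  obtain ⟨Mo, ao, a', c', hao, ha', ha'a, hc', Hout⟩ := hout c hc a₁ ha₁
  refine ⟨max M₀ (max Mi (max Mo 1)), a', min a₀' (min ai ao), c', lt_max_of_lt_right (lt_max_of_lt_right (lt_max_of_lt_right one_pos)), ha',
    lt_min ha₀' (lt_min hai hao), hc', fun i hM α₀ hα₀ hMa U hU hT α₁ hα₁ hα₁a => ?_⟩
  have hM0 : M₀ ≤ (geo i).M := le_trans (le_max_left _ _) hM
  have hMi : Mi ≤ (geo i).M := le_trans (le_trans (le_max_left _ _) (le_max_right _ _)) hM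
  have hMo : Mo ≤ (geo i).M := le_trans (le_trans (le_trans (le_max_left _ _) (le_max_right _ _)) (le_max_right _ _)) hM
  have ha0 : (geo i).M * α₀ ≤ a₀' := le_trans hMa (min_le_left _ _)
  have hai' : (geo i).M * α₀ ≤ ai := le_trans hMa (le_trans (min_le_right _ _) (min_le_left _ _))
  have hao' : (geo i).M * α₀ ≤ ao := le_trans hMa (le_trans (min_le_right _ _) (min_le_right _ _))
  have hT₁ := Hin i hMi α₀ hα₀ hai' U hU hT
  have h₁ := H i hM0 α₀ hα₀ ha0 U hU hT₁ α₁ hα₁ (le_trans hα₁a ha'a)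
  exact Hout i hMo α₀ hα₀ hao' U hU α₁ hα₁ hα₁a h₁

/-! ## §2 Block-shaped outputs: the output domination at the products `U′U` -/

/-- ★ **THE SAME FOR BLOCK-SHAPED OUTPUTS** `Out c i U α₁ := ∀ U′, (3.37)_{α₁}(U, U′) → Blk c i (U′U)`: the output domination is asked at every product `U′U`
with `U` regular above the threshold and `U′` in (3.37) at `0 < α₁ ≦ a′`. [cite: Balaban1985BackgroundPropagators, Thm 3.4 p.400, p.403 l.1–9, (3.35)–(3.37) p.396] -/
theorem stepPos_blk_of_family_pos {C₁ C₂ : Type} {pos₁ : C₁ → Prop} {pos₂ : C₂ → Prop}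
    {Blk₁ : C₁ → ∀ i, (bg i).Cfg → Prop} {Blk₂ : C₂ → ∀ i, (bg i).Cfg → Prop}
    (hin : ∀ (B₀ δ₀ : ℝ) (Bβ Bε : ℝ → ℝ) (Bεβ : ℝ → ℝ → ℝ) (B₁ δ₁ : ℝ), 0 < B₀ → 0 < δ₀ → 0 < B₁ → 0 < δ₁ →
      ∃ (Mi ai B₀' δ₀' : ℝ) (Bβ' Bε' : ℝ → ℝ) (Bεβ' : ℝ → ℝ → ℝ) (B₁' δ₁' : ℝ), 0 < ai ∧ 0 < B₀' ∧ 0 < δ₀' ∧ 0 < B₁' ∧ 0 < δ₁' ∧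
        ∀ i : I, Mi ≤ (geo i).M → ∀ α₀ : ℝ, 0 < α₀ → (geo i).M * α₀ ≤ ai → ∀ U : (bg i).Cfg, (bg i).Reg335 c35 α₀ U →
          Thms31to33IneqAt d (Gp₂ i) (GA₂ i) (Cinv i) B₀ δ₀ Bβ Bε Bεβ B₁ δ₁ U →
          Thms31to33IneqAt d (Gp₁ i) (GA₁ i) (Cinv i) B₀' δ₀' Bβ' Bε' Bεβ' B₁' δ₁' U)
    (hout : ∀ c : C₁, pos₁ c → ∀ a : ℝ, 0 < a →
      ∃ (Mo ao a' : ℝ) (c' : C₂), 0 < ao ∧ 0 < a' ∧ a' ≤ a ∧ pos₂ c' ∧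
        ∀ i : I, Mo ≤ (geo i).M → ∀ α₀ : ℝ, 0 < α₀ → (geo i).M * α₀ ≤ ao → ∀ U : (bg i).Cfg, (bg i).Reg335 c35 α₀ U →
          ∀ α₁ : ℝ, 0 < α₁ → α₁ ≤ a' → ∀ U' : (bg i).Cfg, (bg i).Cplx337 α₁ U U' →
          Blk₁ c i ((bg i).mul U' U) → Blk₂ c' i ((bg i).mul U' U))
    (h : StepPos d c35 geo bg Gp₁ GA₁ Cinv C₁ pos₁ (fun c i U α₁ => ∀ U' : (bg i).Cfg, (bg i).Cplx337 α₁ U U' → Blk₁ c i ((bg i).mul U' U))) :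
    StepPos d c35 geo bg Gp₂ GA₂ Cinv C₂ pos₂ (fun c i U α₁ => ∀ U' : (bg i).Cfg, (bg i).Cplx337 α₁ U U' → Blk₂ c i ((bg i).mul U' U)) := by
  refine stepPos_of_family_pos d c35 geo bg Gp₁ Gp₂ GA₁ GA₂ Cinv hin (fun c hc a ha => ?_) h
  obtain ⟨Mo, ao, a', c', hao, ha', ha'a, hc', Hout⟩ := hout c hc a ha
  exact ⟨Mo, ao, a', c', hao, ha', ha'a, hc', fun i hM α₀ hα₀ hMa U hU α₁ hα₁ hα₁a h₁ U' hU' =>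
    Hout i hM α₀ hα₀ hMa U hU α₁ hα₁ hα₁a U' hU' (h₁ U' hU')⟩

/-! ## §3 Block-shaped outputs read along a coding come back to the record -/

/-- ★ **THE POSITIVE-INPUT BLOCK-STEP TRANSFERS FROM THE CODING BACK TO THE RECORD — ANY BLOCK** (as `B9SectBCodedCarrier.sectBStepPrinted_of_coded`, for one
block-shaped output): if the step holds for the pulled-back input families over the coded carriers with a coded output block `Blkc` that DOMINATES the record's
block read along the decoding (`hBlk : Blkc c i W → Blk c i (dec W)`; for the pulled-back output families `pullK 𝔠 K` this is `id` by `rfl`), and the class implication `hclass` codes every `U′` of the record's (3.37) at `α₁ ≦ αcap` by some `a` with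
`C37 (r·α₁) U a`, then the step holds for the record's families with the output block at `U′U`: thresholds `max M₀ Mc`, caps `min (a₁/r) αcap`, `min a₀′ ac`,
constants unchanged (the step at `(U, U′)` is the coded step at `(base U, mult a)`, read at `dec (prod U a) = U′U`).
[cite: Balaban1985BackgroundPropagators, Thm 3.4 p.400, Thm 3.1 (3.42)–(3.47) pp.397–398, (3.35)–(3.37) p.396] -/
theorem stepPos_blk_of_coded (𝔠 : ∀ i, Coding (bg i)) {C : Type} {pos : C → Prop} (Blkc : C → ∀ i, (𝔠 i).bg.Cfg → Prop)
    (Blk : C → ∀ i, (bg i).Cfg → Prop) (hBlk : ∀ (c : C) (i : I) (W : (𝔠 i).bg.Cfg), Blkc c i W → Blk c i ((𝔠 i).dec W))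
    {r αcap Mc ac : ℝ} (hr : 0 < r) (hcap : 0 < αcap) (hac : 0 < ac)
    (hclass : ∀ (i : I) (α₀ α₁ : ℝ) (U U' : (bg i).Cfg), Mc ≤ (geo i).M → 0 < α₀ → (geo i).M * α₀ ≤ ac →
      (bg i).Reg335 c35 α₀ U → 0 < α₁ → α₁ ≤ αcap → (bg i).Cplx337 α₁ U U' →
      ∃ a : (𝔠 i).A, (𝔠 i).decA a = U' ∧ (𝔠 i).C37 (r * α₁) U a)
    (h : StepPos d c35 geo (fun i => (𝔠 i).bg) (fun i => pullK (𝔠 i) (Gp₁ i)) (fun i => pullK (𝔠 i) (GA₁ i)) (fun i => pullS (𝔠 i) (Cinv i)) C pos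
      (fun c i V α₁ => ∀ V' : (𝔠 i).bg.Cfg, (𝔠 i).bg.Cplx337 α₁ V V' → Blkc c i ((𝔠 i).bg.mul V' V))) :
    StepPos d c35 geo bg Gp₁ GA₁ Cinv C pos (fun c i U α₁ => ∀ U' : (bg i).Cfg, (bg i).Cplx337 α₁ U U' → Blk c i ((bg i).mul U' U)) := by
  intro B₀ δ₀ Bβ Bε Bεβ B₁ δ₁ hB₀ hδ₀ hB₁ hδ₁
  obtain ⟨M₀, a₁, a₀', c, hM₀, ha₁, ha₀', hc, H⟩ := h B₀ δ₀ Bβ Bε Bεβ B₁ δ₁ hB₀ hδ₀ hB₁ hδ₁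
  refine ⟨max M₀ Mc, min (a₁ / r) αcap, min a₀' ac, c, lt_max_of_lt_left hM₀, lt_min (div_pos ha₁ hr) hcap, lt_min ha₀' hac, hc,
    fun i hM α₀ hα₀ hMα U hU hT α₁ hα₁ hα₁a U' hU' => ?_⟩
  have hM0 : M₀ ≤ (geo i).M := le_trans (le_max_left _ _) hM
  have hMc : Mc ≤ (geo i).M := le_trans (le_max_right _ _) hM
  have hMa : (geo i).M * α₀ ≤ a₀' := le_trans hMα (min_le_left _ _)
  have hMac : (geo i).M * α₀ ≤ ac := le_trans hMα (min_le_right _ _)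
  have hrα : 0 < r * α₁ := mul_pos hr hα₁
  have hrα₁ : r * α₁ ≤ a₁ := by
    have h1 : α₁ ≤ a₁ / r := le_trans hα₁a (min_le_left _ _)
    calc r * α₁ ≤ r * (a₁ / r) := mul_le_mul_of_nonneg_left h1 hr.le
      _ = a₁ := mul_div_cancel₀ a₁ hr.ne'
  have hαcap : α₁ ≤ αcap := le_trans hα₁a (min_le_right _ _)
  have hTc : Thms31to33IneqAt d (pullK (𝔠 i) (Gp₁ i)) (pullK (𝔠 i) (GA₁ i)) (pullS (𝔠 i) (Cinv i)) B₀ δ₀ Bβ Bε Bεβ B₁ δ₁ (.base U) :=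
    (B9SectBCodedCarrier.thms31to33IneqAt_pull_iff (𝔠 i) d (Gp₁ i) (GA₁ i) (Cinv i) B₀ δ₀ Bβ Bε Bεβ B₁ δ₁ (.base U)).2 hT
  obtain ⟨a, ha, hC⟩ := hclass i α₀ α₁ U U' hMc hα₀ hMac hU hα₁ hαcap hU'
  have key := H i hM0 α₀ hα₀ hMa (.base U) (((𝔠 i).bg_Reg335_base c35 α₀ U).2 hU) hTc (r * α₁) hrα hrα₁ (.mult a)
    (((𝔠 i).bg_Cplx337_base_mult (r * α₁) U a).2 hC)
  have e : (𝔠 i).dec ((𝔠 i).bg.mul (.mult a) (.base U)) = (bg i).mul U' U := by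
    rw [B9SectBCodedCarrier.Coding.dec_bg_mul_mult_base, ha]
  rw [← e]
  exact hBlk c i _ key

/-! ## §3b Base-read outputs (no `U′`) read along a coding come back to the record -/

/-- ★ **THE POSITIVE-INPUT STEP TRANSFERS FROM THE CODING BACK TO THE RECORD — OUTPUTS READ AT THE BASE** (the analytic-extension member: Theorem 3.4's
«extend to configurations U′U … as analytic functions of A′», an assertion about `U` and the exponent `α₁`, no `U′` quantified): if the step holds over the coded
carriers with an output `Outc` whose value at `(base U, r·β)` dominates the record's output at `(U, β)` (`hOut`; `r > 0` the exponent rescaling of the class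
implication, as in `B9SectBCodedCarrier.pullAn`), then the step holds for the record: thresholds unchanged, cap `a₁/r`.
[cite: Balaban1985BackgroundPropagators, Thm 3.4 p.400, (3.62)–(3.64) p.402, (3.35) p.396] -/
theorem stepPos_base_of_coded (𝔠 : ∀ i, Coding (bg i)) {C : Type} {pos : C → Prop} (Outc : C → ∀ i, (𝔠 i).bg.Cfg → ℝ → Prop)
    (Out : C → ∀ i, (bg i).Cfg → ℝ → Prop) {r : ℝ} (hr : 0 < r)
    (hOut : ∀ (c : C) (i : I) (U : (bg i).Cfg) (β : ℝ), Outc c i (.base U) (r * β) → Out c i U β)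
    (h : StepPos d c35 geo (fun i => (𝔠 i).bg) (fun i => pullK (𝔠 i) (Gp₁ i)) (fun i => pullK (𝔠 i) (GA₁ i)) (fun i => pullS (𝔠 i) (Cinv i)) C pos Outc) :
    StepPos d c35 geo bg Gp₁ GA₁ Cinv C pos Out := by
  intro B₀ δ₀ Bβ Bε Bεβ B₁ δ₁ hB₀ hδ₀ hB₁ hδ₁
  obtain ⟨M₀, a₁, a₀', c, hM₀, ha₁, ha₀', hc, H⟩ := h B₀ δ₀ Bβ Bε Bεβ B₁ δ₁ hB₀ hδ₀ hB₁ hδ₁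
  refine ⟨M₀, a₁ / r, a₀', c, hM₀, div_pos ha₁ hr, ha₀', hc, fun i hM α₀ hα₀ hMα U hU hT α₁ hα₁ hα₁a => ?_⟩
  have hrα : 0 < r * α₁ := mul_pos hr hα₁
  have hrα₁ : r * α₁ ≤ a₁ := by
    calc r * α₁ ≤ r * (a₁ / r) := mul_le_mul_of_nonneg_left hα₁a hr.le
      _ = a₁ := mul_div_cancel₀ a₁ hr.ne'
  have hTc : Thms31to33IneqAt d (pullK (𝔠 i) (Gp₁ i)) (pullK (𝔠 i) (GA₁ i)) (pullS (𝔠 i) (Cinv i)) B₀ δ₀ Bβ Bε Bεβ B₁ δ₁ (.base U) :=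
    (B9SectBCodedCarrier.thms31to33IneqAt_pull_iff (𝔠 i) d (Gp₁ i) (GA₁ i) (Cinv i) B₀ δ₀ Bβ Bε Bεβ B₁ δ₁ (.base U)).2 hT
  exact hOut c i U α₁ (H i hM α₀ hα₀ hMα (.base U) (((𝔠 i).bg_Reg335_base c35 α₀ U).2 hU) hTc (r * α₁) hrα hrα₁)

/-! ## §4 The named blocks -/

section Named

variable (K : ∀ i, KernelFamily (geo i) (bg i)) (𝔠 : ∀ i, Coding (bg i)) {r αcap Mc ac : ℝ} (hr : 0 < r) (hcap : 0 < αcap) (hac : 0 < ac)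
  (hclass : ∀ (i : I) (α₀ α₁ : ℝ) (U U' : (bg i).Cfg), Mc ≤ (geo i).M → 0 < α₀ → (geo i).M * α₀ ≤ ac →
    (bg i).Reg335 c35 α₀ U → 0 < α₁ → α₁ ≤ αcap → (bg i).Cplx337 α₁ U U' →
    ∃ a : (𝔠 i).A, (𝔠 i).decA a = U' ∧ (𝔠 i).C37 (r * α₁) U a)
include hr hcap hac hclass

/-- **(3.42) block-step from the coding back to the record** (`stepPos_blk_of_coded` at `Blk c i V := EBlock (K i) c.1 c.2 V`; the pulled-back output family
`pullK 𝔠 K` reads `K` along the decoding by `rfl`). [cite: Balaban1985BackgroundPropagators, Thm 3.4 p.400, (3.42) p.397, (3.37) p.396] -/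
theorem stepEPos_of_coded
    (h : StepEPos d c35 geo (fun i => (𝔠 i).bg) (fun i => pullK (𝔠 i) (Gp₁ i)) (fun i => pullK (𝔠 i) (GA₁ i)) (fun i => pullS (𝔠 i) (Cinv i))
      (fun i => pullK (𝔠 i) (K i))) :
    StepEPos d c35 geo bg Gp₁ GA₁ Cinv K :=
  stepPos_blk_of_coded d c35 geo bg Gp₁ GA₁ Cinv 𝔠 (C := ℝ × ℝ) (pos := fun c => 0 < c.1 ∧ 0 < c.2)
    (fun c i W => EBlock (pullK (𝔠 i) (K i)) c.1 c.2 W)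
    (fun c i V => EBlock (K i) c.1 c.2 V) (fun _ _ _ hW => hW) hr hcap hac hclass h

/-- **(3.47) block-step from the coding back to the record.** [cite: Balaban1985BackgroundPropagators, Thm 3.4 p.400, (3.47) p.398, (3.37) p.396] -/
theorem stepGlobPos_of_coded
    (h : StepGlobPos d c35 geo (fun i => (𝔠 i).bg) (fun i => pullK (𝔠 i) (Gp₁ i)) (fun i => pullK (𝔠 i) (GA₁ i)) (fun i => pullS (𝔠 i) (Cinv i))
      (fun i => pullK (𝔠 i) (K i))) :
    StepGlobPos d c35 geo bg Gp₁ GA₁ Cinv K :=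
  stepPos_blk_of_coded d c35 geo bg Gp₁ GA₁ Cinv 𝔠 (C := ℝ) (pos := fun c => 0 < c)
    (fun c i W => GlobBlock (pullK (𝔠 i) (K i)) c W)
    (fun c i V => GlobBlock (K i) c V) (fun _ _ _ hW => hW) hr hcap hac hclass h

/-- **(3.43) block-step from the coding back to the record.** [cite: Balaban1985BackgroundPropagators, Thm 3.4 p.400, (3.43) p.398, (3.37) p.396] -/
theorem stepH1Pos_of_coded
    (h : StepH1Pos d c35 geo (fun i => (𝔠 i).bg) (fun i => pullK (𝔠 i) (Gp₁ i)) (fun i => pullK (𝔠 i) (GA₁ i)) (fun i => pullS (𝔠 i) (Cinv i))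
      (fun i => pullK (𝔠 i) (K i))) :
    StepH1Pos d c35 geo bg Gp₁ GA₁ Cinv K :=
  stepPos_blk_of_coded d c35 geo bg Gp₁ GA₁ Cinv 𝔠 (C := (ℝ → ℝ) × ℝ) (pos := fun c => 0 < c.2)
    (fun c i W => H1Block (pullK (𝔠 i) (K i)) c.1 c.2 W)
    (fun c i V => H1Block (K i) c.1 c.2 V) (fun _ _ _ hW => hW) hr hcap hac hclass h

/-- **(3.44) block-step from the coding back to the record.** [cite: Balaban1985BackgroundPropagators, Thm 3.4 p.400, (3.44) p.398, (3.37) p.396] -/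
theorem stepE4Pos_of_coded
    (h : StepE4Pos d c35 geo (fun i => (𝔠 i).bg) (fun i => pullK (𝔠 i) (Gp₁ i)) (fun i => pullK (𝔠 i) (GA₁ i)) (fun i => pullS (𝔠 i) (Cinv i))
      (fun i => pullK (𝔠 i) (K i))) :
    StepE4Pos d c35 geo bg Gp₁ GA₁ Cinv K :=
  stepPos_blk_of_coded d c35 geo bg Gp₁ GA₁ Cinv 𝔠 (C := (ℝ → ℝ) × ℝ) (pos := fun c => 0 < c.2)
    (fun c i W => E4Block (pullK (𝔠 i) (K i)) c.1 c.2 W)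
    (fun c i V => E4Block (K i) c.1 c.2 V) (fun _ _ _ hW => hW) hr hcap hac hclass h

/-- **(3.45) block-step from the coding back to the record.** [cite: Balaban1985BackgroundPropagators, Thm 3.4 p.400, (3.45) p.398, (3.37) p.396] -/
theorem stepH2Pos_of_coded
    (h : StepH2Pos d c35 geo (fun i => (𝔠 i).bg) (fun i => pullK (𝔠 i) (Gp₁ i)) (fun i => pullK (𝔠 i) (GA₁ i)) (fun i => pullS (𝔠 i) (Cinv i))
      (fun i => pullK (𝔠 i) (K i))) :
    StepH2Pos d c35 geo bg Gp₁ GA₁ Cinv K :=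
  stepPos_blk_of_coded d c35 geo bg Gp₁ GA₁ Cinv 𝔠 (C := (ℝ → ℝ → ℝ) × ℝ) (pos := fun c => 0 < c.2)
    (fun c i W => H2Block (pullK (𝔠 i) (K i)) c.1 c.2 W)
    (fun c i V => H2Block (K i) c.1 c.2 V) (fun _ _ _ hW => hW) hr hcap hac hclass h

/-- **(3.46)ₙ block-step from the coding back to the record** (member `n`). [cite: Balaban1985BackgroundPropagators, Thm 3.4 p.400, (3.46) p.398, (3.37) p.396] -/
theorem stepL2nPos_of_coded (n : Fin 6)
    (h : StepL2nPos d c35 geo (fun i => (𝔠 i).bg) (fun i => pullK (𝔠 i) (Gp₁ i)) (fun i => pullK (𝔠 i) (GA₁ i)) (fun i => pullS (𝔠 i) (Cinv i))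
      (fun i => pullK (𝔠 i) (K i)) n) :
    StepL2nPos d c35 geo bg Gp₁ GA₁ Cinv K n :=
  stepPos_blk_of_coded d c35 geo bg Gp₁ GA₁ Cinv 𝔠 (C := ℝ × ℝ) (pos := fun c => 0 < c.1 ∧ 0 < c.2)
    (fun c i W => ∀ (lam : (geo i).Loc) (h : (geo i).Cut) (y y' : (geo i).Site), (geo i).cutIn h y → (geo i).suppIn lam y' →
      (pullK (𝔠 i) (K i)).l2 n W lam h ≤
        c.1 * B9.pref6 ((geo i).len y) n * (geo i).cutSup h * Real.exp (-(c.2 * (geo i).dist y y')) * (geo i).l2Norm lam)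
    (fun c i V => ∀ (lam : (geo i).Loc) (h : (geo i).Cut) (y y' : (geo i).Site), (geo i).cutIn h y → (geo i).suppIn lam y' →
      (K i).l2 n V lam h ≤ c.1 * B9.pref6 ((geo i).len y) n * (geo i).cutSup h * Real.exp (-(c.2 * (geo i).dist y y')) * (geo i).l2Norm lam)
    (fun _ _ _ hW => hW) hr hcap hac hclass h

/-- **(3.48) block-step from the coding back to the record** (the output two-point kernel `S` read along the decoding, `pullS 𝔠 S`).
[cite: Balaban1985BackgroundPropagators, Thm 3.4 p.400, Thm 3.2 (3.48) p.398, (3.65)–(3.67) p.403, (3.37) p.396] -/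
theorem stepKerPos_of_coded (S : ∀ i, SiteKernel (geo i) (bg i))
    (h : StepKerPos d c35 geo (fun i => (𝔠 i).bg) (fun i => pullK (𝔠 i) (Gp₁ i)) (fun i => pullK (𝔠 i) (GA₁ i)) (fun i => pullS (𝔠 i) (Cinv i))
      (fun i => pullS (𝔠 i) (S i))) :
    StepKerPos d c35 geo bg Gp₁ GA₁ Cinv S :=
  stepPos_blk_of_coded d c35 geo bg Gp₁ GA₁ Cinv 𝔠 (C := ℝ × ℝ) (pos := fun c => 0 < c.1 ∧ 0 < c.2)
    (fun c i W => ∀ y y' : (geo i).Site, |(pullS (𝔠 i) (S i)).ker W y y'| ≤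
      c.1 * ((geo i).len y) ^ (-(4 : ℝ)) * ((geo i).len y') ^ (-(d : ℝ)) * Real.exp (-(c.2 * (geo i).dist y y')))
    (fun c i V => ∀ y y' : (geo i).Site, |(S i).ker V y y'| ≤
      c.1 * ((geo i).len y) ^ (-(4 : ℝ)) * ((geo i).len y') ^ (-(d : ℝ)) * Real.exp (-(c.2 * (geo i).dist y y')))
    (fun _ _ _ hW => hW) hr hcap hac hclass h

end Named

/-! ## §5 The named blocks: transfers between mutually dominating readings (output families `K₁ ↦ K₂`) -/

section NamedFamily

variable (K₁ K₂ : ∀ i, KernelFamily (geo i) (bg i))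
  (hin : ∀ (B₀ δ₀ : ℝ) (Bβ Bε : ℝ → ℝ) (Bεβ : ℝ → ℝ → ℝ) (B₁ δ₁ : ℝ), 0 < B₀ → 0 < δ₀ → 0 < B₁ → 0 < δ₁ →
    ∃ (Mi ai B₀' δ₀' : ℝ) (Bβ' Bε' : ℝ → ℝ) (Bεβ' : ℝ → ℝ → ℝ) (B₁' δ₁' : ℝ), 0 < ai ∧ 0 < B₀' ∧ 0 < δ₀' ∧ 0 < B₁' ∧ 0 < δ₁' ∧
      ∀ i : I, Mi ≤ (geo i).M → ∀ α₀ : ℝ, 0 < α₀ → (geo i).M * α₀ ≤ ai → ∀ U : (bg i).Cfg, (bg i).Reg335 c35 α₀ U →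
        Thms31to33IneqAt d (Gp₂ i) (GA₂ i) (Cinv i) B₀ δ₀ Bβ Bε Bεβ B₁ δ₁ U →
        Thms31to33IneqAt d (Gp₁ i) (GA₁ i) (Cinv i) B₀' δ₀' Bβ' Bε' Bεβ' B₁' δ₁' U)
include hin

/-- **(3.42) block-step between mutually dominating readings**: `hout` = for `(B, δ) > 0` and a cap, a threshold and `(B′, δ′) > 0` with
`EBlock (K₁ i) B δ (U′U) → EBlock (K₂ i) B′ δ′ (U′U)` at the products. [cite: Balaban1985BackgroundPropagators, Thm 3.4 p.400, (3.42) p.397, p.403 l.1–9] -/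
theorem stepEPos_of_family_pos
    (hout : ∀ (B δ a : ℝ), 0 < B → 0 < δ → 0 < a →
      ∃ (Mo ao a' B' δ' : ℝ), 0 < ao ∧ 0 < a' ∧ a' ≤ a ∧ 0 < B' ∧ 0 < δ' ∧
        ∀ i : I, Mo ≤ (geo i).M → ∀ α₀ : ℝ, 0 < α₀ → (geo i).M * α₀ ≤ ao → ∀ U : (bg i).Cfg, (bg i).Reg335 c35 α₀ U →
          ∀ α₁ : ℝ, 0 < α₁ → α₁ ≤ a' → ∀ U' : (bg i).Cfg, (bg i).Cplx337 α₁ U U' →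
          EBlock (K₁ i) B δ ((bg i).mul U' U) → EBlock (K₂ i) B' δ' ((bg i).mul U' U))
    (h : StepEPos d c35 geo bg Gp₁ GA₁ Cinv K₁) : StepEPos d c35 geo bg Gp₂ GA₂ Cinv K₂ := by
  refine stepPos_blk_of_family_pos d c35 geo bg Gp₁ Gp₂ GA₁ GA₂ Cinv hin (fun c hc a ha => ?_) h
  obtain ⟨Mo, ao, a', B', δ', hao, ha', ha'a, hB', hδ', H⟩ := hout c.1 c.2 a hc.1 hc.2 ha
  exact ⟨Mo, ao, a', (B', δ'), hao, ha', ha'a, ⟨hB', hδ'⟩, H⟩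

/-- **(3.47) block-step between mutually dominating readings.** [cite: Balaban1985BackgroundPropagators, Thm 3.4 p.400, (3.47) p.398, p.403 l.1–9] -/
theorem stepGlobPos_of_family_pos
    (hout : ∀ (B a : ℝ), 0 < B → 0 < a →
      ∃ (Mo ao a' B' : ℝ), 0 < ao ∧ 0 < a' ∧ a' ≤ a ∧ 0 < B' ∧
        ∀ i : I, Mo ≤ (geo i).M → ∀ α₀ : ℝ, 0 < α₀ → (geo i).M * α₀ ≤ ao → ∀ U : (bg i).Cfg, (bg i).Reg335 c35 α₀ U →
          ∀ α₁ : ℝ, 0 < α₁ → α₁ ≤ a' → ∀ U' : (bg i).Cfg, (bg i).Cplx337 α₁ U U' →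
          GlobBlock (K₁ i) B ((bg i).mul U' U) → GlobBlock (K₂ i) B' ((bg i).mul U' U))
    (h : StepGlobPos d c35 geo bg Gp₁ GA₁ Cinv K₁) : StepGlobPos d c35 geo bg Gp₂ GA₂ Cinv K₂ := by
  refine stepPos_blk_of_family_pos d c35 geo bg Gp₁ Gp₂ GA₁ GA₂ Cinv hin (fun c hc a ha => ?_) h
  obtain ⟨Mo, ao, a', B', hao, ha', ha'a, hB', H⟩ := hout c a hc ha
  exact ⟨Mo, ao, a', B', hao, ha', ha'a, hB', H⟩

/-- **(3.43) block-step between mutually dominating readings.** [cite: Balaban1985BackgroundPropagators, Thm 3.4 p.400, (3.43) p.398, p.403 l.1–9] -/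
theorem stepH1Pos_of_family_pos
    (hout : ∀ (Bβ : ℝ → ℝ) (δ a : ℝ), 0 < δ → 0 < a →
      ∃ (Mo ao a' : ℝ) (Bβ' : ℝ → ℝ) (δ' : ℝ), 0 < ao ∧ 0 < a' ∧ a' ≤ a ∧ 0 < δ' ∧
        ∀ i : I, Mo ≤ (geo i).M → ∀ α₀ : ℝ, 0 < α₀ → (geo i).M * α₀ ≤ ao → ∀ U : (bg i).Cfg, (bg i).Reg335 c35 α₀ U →
          ∀ α₁ : ℝ, 0 < α₁ → α₁ ≤ a' → ∀ U' : (bg i).Cfg, (bg i).Cplx337 α₁ U U' →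
          H1Block (K₁ i) Bβ δ ((bg i).mul U' U) → H1Block (K₂ i) Bβ' δ' ((bg i).mul U' U))
    (h : StepH1Pos d c35 geo bg Gp₁ GA₁ Cinv K₁) : StepH1Pos d c35 geo bg Gp₂ GA₂ Cinv K₂ := by
  refine stepPos_blk_of_family_pos d c35 geo bg Gp₁ Gp₂ GA₁ GA₂ Cinv hin (fun c hc a ha => ?_) h
  obtain ⟨Mo, ao, a', Bβ', δ', hao, ha', ha'a, hδ', H⟩ := hout c.1 c.2 a hc ha
  exact ⟨Mo, ao, a', (Bβ', δ'), hao, ha', ha'a, hδ', H⟩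

/-- **(3.44) block-step between mutually dominating readings.** [cite: Balaban1985BackgroundPropagators, Thm 3.4 p.400, (3.44) p.398, p.403 l.1–9] -/
theorem stepE4Pos_of_family_pos
    (hout : ∀ (Bε : ℝ → ℝ) (δ a : ℝ), 0 < δ → 0 < a →
      ∃ (Mo ao a' : ℝ) (Bε' : ℝ → ℝ) (δ' : ℝ), 0 < ao ∧ 0 < a' ∧ a' ≤ a ∧ 0 < δ' ∧
        ∀ i : I, Mo ≤ (geo i).M → ∀ α₀ : ℝ, 0 < α₀ → (geo i).M * α₀ ≤ ao → ∀ U : (bg i).Cfg, (bg i).Reg335 c35 α₀ U →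
          ∀ α₁ : ℝ, 0 < α₁ → α₁ ≤ a' → ∀ U' : (bg i).Cfg, (bg i).Cplx337 α₁ U U' →
          E4Block (K₁ i) Bε δ ((bg i).mul U' U) → E4Block (K₂ i) Bε' δ' ((bg i).mul U' U))
    (h : StepE4Pos d c35 geo bg Gp₁ GA₁ Cinv K₁) : StepE4Pos d c35 geo bg Gp₂ GA₂ Cinv K₂ := by
  refine stepPos_blk_of_family_pos d c35 geo bg Gp₁ Gp₂ GA₁ GA₂ Cinv hin (fun c hc a ha => ?_) h
  obtain ⟨Mo, ao, a', Bε', δ', hao, ha', ha'a, hδ', H⟩ := hout c.1 c.2 a hc ha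
  exact ⟨Mo, ao, a', (Bε', δ'), hao, ha', ha'a, hδ', H⟩

/-- **(3.45) block-step between mutually dominating readings.** [cite: Balaban1985BackgroundPropagators, Thm 3.4 p.400, (3.45) p.398, p.403 l.1–9] -/
theorem stepH2Pos_of_family_pos
    (hout : ∀ (Bεβ : ℝ → ℝ → ℝ) (δ a : ℝ), 0 < δ → 0 < a →
      ∃ (Mo ao a' : ℝ) (Bεβ' : ℝ → ℝ → ℝ) (δ' : ℝ), 0 < ao ∧ 0 < a' ∧ a' ≤ a ∧ 0 < δ' ∧
        ∀ i : I, Mo ≤ (geo i).M → ∀ α₀ : ℝ, 0 < α₀ → (geo i).M * α₀ ≤ ao → ∀ U : (bg i).Cfg, (bg i).Reg335 c35 α₀ U →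
          ∀ α₁ : ℝ, 0 < α₁ → α₁ ≤ a' → ∀ U' : (bg i).Cfg, (bg i).Cplx337 α₁ U U' →
          H2Block (K₁ i) Bεβ δ ((bg i).mul U' U) → H2Block (K₂ i) Bεβ' δ' ((bg i).mul U' U))
    (h : StepH2Pos d c35 geo bg Gp₁ GA₁ Cinv K₁) : StepH2Pos d c35 geo bg Gp₂ GA₂ Cinv K₂ := by
  refine stepPos_blk_of_family_pos d c35 geo bg Gp₁ Gp₂ GA₁ GA₂ Cinv hin (fun c hc a ha => ?_) h
  obtain ⟨Mo, ao, a', Bεβ', δ', hao, ha', ha'a, hδ', H⟩ := hout c.1 c.2 a hc ha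
  exact ⟨Mo, ao, a', (Bεβ', δ'), hao, ha', ha'a, hδ', H⟩

/-- **(3.48) block-step between mutually dominating readings** (output two-point kernels `S₁ ↦ S₂`).
[cite: Balaban1985BackgroundPropagators, Thm 3.4 p.400, Thm 3.2 (3.48) p.398, p.403 l.1–9] -/
theorem stepKerPos_of_family_pos (S₁ S₂ : ∀ i, SiteKernel (geo i) (bg i))
    (hout : ∀ (B δ a : ℝ), 0 < B → 0 < δ → 0 < a →
      ∃ (Mo ao a' B' δ' : ℝ), 0 < ao ∧ 0 < a' ∧ a' ≤ a ∧ 0 < B' ∧ 0 < δ' ∧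
        ∀ i : I, Mo ≤ (geo i).M → ∀ α₀ : ℝ, 0 < α₀ → (geo i).M * α₀ ≤ ao → ∀ U : (bg i).Cfg, (bg i).Reg335 c35 α₀ U →
          ∀ α₁ : ℝ, 0 < α₁ → α₁ ≤ a' → ∀ U' : (bg i).Cfg, (bg i).Cplx337 α₁ U U' →
          (∀ y y' : (geo i).Site, |(S₁ i).ker ((bg i).mul U' U) y y'| ≤
            B * ((geo i).len y) ^ (-(4 : ℝ)) * ((geo i).len y') ^ (-(d : ℝ)) * Real.exp (-(δ * (geo i).dist y y'))) →
          (∀ y y' : (geo i).Site, |(S₂ i).ker ((bg i).mul U' U) y y'| ≤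
            B' * ((geo i).len y) ^ (-(4 : ℝ)) * ((geo i).len y') ^ (-(d : ℝ)) * Real.exp (-(δ' * (geo i).dist y y'))))
    (h : StepKerPos d c35 geo bg Gp₁ GA₁ Cinv S₁) : StepKerPos d c35 geo bg Gp₂ GA₂ Cinv S₂ := by
  refine stepPos_blk_of_family_pos d c35 geo bg Gp₁ Gp₂ GA₁ GA₂ Cinv (C₁ := ℝ × ℝ) (C₂ := ℝ × ℝ)
    (pos₁ := fun c => 0 < c.1 ∧ 0 < c.2) (pos₂ := fun c => 0 < c.1 ∧ 0 < c.2)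
    (Blk₁ := fun c i V => ∀ y y' : (geo i).Site, |(S₁ i).ker V y y'| ≤
      c.1 * ((geo i).len y) ^ (-(4 : ℝ)) * ((geo i).len y') ^ (-(d : ℝ)) * Real.exp (-(c.2 * (geo i).dist y y')))
    (Blk₂ := fun c i V => ∀ y y' : (geo i).Site, |(S₂ i).ker V y y'| ≤
      c.1 * ((geo i).len y) ^ (-(4 : ℝ)) * ((geo i).len y') ^ (-(d : ℝ)) * Real.exp (-(c.2 * (geo i).dist y y')))
    hin (fun c hc a ha => ?_) h
  obtain ⟨Mo, ao, a', B', δ', hao, ha', ha'a, hB', hδ', H⟩ := hout c.1 c.2 a hc.1 hc.2 ha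
  exact ⟨Mo, ao, a', (B', δ'), hao, ha', ha'a, ⟨hB', hδ'⟩, H⟩

end NamedFamily

end Literature.MathematicalPhysics.QuantumFieldTheory.Balaban1983to89.B9SectBStepPosFamilyTransfer
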